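import Mathlib
import HarnessLib

/-!
# Clifford's theorem in index two (abstract form): an irreducible representation that becomes
# reducible on a subgroup of index two splits as `U ⊕ π(g)U`

Crux `AbelianSurfaceSerre.QuadraticImprimitiveSurfaces` (stmt-Langlands-17766), `--supports` helpers:
the representation-theoretic core of the "routine Clifford step" `ImprimitiveIsInduced` of the
crux-ideate cards (every GL₂/K line of the crux, and the printed proof of BCGP 2025 Lemma 10.4.1
for type **B**[C₂], start from "`r` irreducible, `r|Γ_K` reducible ⟹ `r ≅ Ind_K^ℚ s`").
Everything here is PROVED (no named fact), over an arbitrary field and for an arbitrary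
homomorphism `φ : H →* G` whose image has index `2`:

* `stable_sup_inf_of_index_two` — for a `φ(H)`-stable `U₀` and `g ∉ φ(H)`, the
  subspaces `U₀ + π(g)U₀` and `U₀ ∩ π(g)U₀` are `G`-stable;
* `exists_isCompl_of_not_isIrreducible_comp` — CLIFFORD: `π` irreducible, `π ∘ φ`
  not irreducible ⟹ a sub-`H`-representation `W ≠ 0, V` with `V = W ⊕ π(g)W` for every `g ∉ φ(H)`;
* `finrank_eq_two_mul_of_isCompl_map` — then `dim V = 2 dim W`;
* `isIrreducible_toRepresentation_of_index_two` — and `W` is an irreducible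
  `H`-representation.

The framed / Galois consequences (`r ≅ Ind s` at the level of characteristic polynomials, with the
tree's `FramedGaloisRep.induce`) are in the companion file
`AbelianSurfaceSerreQuadraticImprimitiveSurfacesCliffordInduced.lean`.

References: A. H. Clifford, *Representations induced in an invariant subgroup*, Ann. of Math. 38
(1937), Thm. 1 [Clifford1937]; C. W. Curtis, I. Reiner, *Representation Theory of Finite Groups and
Associative Algebras* (1962), (49.2), (49.7) [CurtisReiner1962]; J.-P. Serre, *Linear
representations of finite groups*, §7.3–7.4 [SerreLinearRepresentations1977].
-/

noncomputable section

set_option linter.dupNamespace false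

namespace Summit.Langlands.Langlands.Cruxes.QuadraticImprimitiveSurfaces.Clifford

/-! ### Abstract Clifford theory in index two -/

section Abstract

variable {k : Type*} [Field k] {G H : Type*} [Group G] [Group H] {V : Type*} [AddCommGroup V]
  [Module k V]

/-- The operators `π g` are injective (they are invertible). [folklore] -/
theorem representation_apply_injective (π : _root_.Representation k G V) (g : G) :
    Function.Injective (π g) := fun v w h => by
  have := congrArg (π g⁻¹) h
  rwa [← Module.End.mul_apply, ← map_mul, inv_mul_cancel, map_one, Module.End.one_apply,
    ← Module.End.mul_apply, ← map_mul, inv_mul_cancel, map_one, Module.End.one_apply] at this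

/-- **The two `G`-stable subspaces of Clifford's argument.**  If `φ : H →* G` has image `N` of index
`2`, `U₀` is a `φ(H)`-stable subspace and `g ∉ N`, then `U₀ + π(g)U₀` and `U₀ ∩ π(g)U₀` are stable
under ALL of `G` (`N` is normal, `G = N ∪ gN`: `N` preserves both summands, `G ∖ N` swaps them).
[cite: Clifford1937, Thm. 1] -/
theorem stable_sup_inf_of_index_two (π : _root_.Representation k G V) (φ : H →* G)
    (hφ : φ.range.index = 2) {U₀ : Submodule k V} (hU₀ : ∀ (h : H), ∀ v ∈ U₀, π (φ h) v ∈ U₀)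
    {g : G} (hg : g ∉ φ.range) (x : G) :
    (∀ v ∈ U₀ ⊔ U₀.map (π g), π x v ∈ U₀ ⊔ U₀.map (π g)) ∧
      ∀ v ∈ U₀ ⊓ U₀.map (π g), π x v ∈ U₀ ⊓ U₀.map (π g) := by
  set N : Subgroup G := φ.range with hNdef
  haveI hN : N.Normal := Subgroup.normal_of_index_eq_two hφ
  have hmul : ∀ {a b : G}, a ∉ N → b ∉ N → a * b ∈ N := fun ha hb =>
    (Subgroup.mul_mem_iff_of_index_two hφ).mpr (iff_of_false ha hb)
  have hcomp : ∀ (a b : G) (v : V), π a (π b v) = π (a * b) v := fun a b v => by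
    rw [map_mul]; rfl
  have hNU : ∀ x ∈ N, ∀ v ∈ U₀, π x v ∈ U₀ := by
    rintro _ ⟨h, rfl⟩ v hv
    exact hU₀ h v hv
  have hginv : g⁻¹ ∉ N := fun h => hg (by simpa using N.inv_mem h)
  set U' : Submodule k V := U₀.map (π g) with hU'def
  have hNU' : ∀ x ∈ N, ∀ v ∈ U', π x v ∈ U' := by
    intro x hx v hv
    obtain ⟨u, hu, rfl⟩ := Submodule.mem_map.mp hv
    rw [hcomp, show x * g = g * (g⁻¹ * x * g) by group, ← hcomp]
    exact Submodule.mem_map_of_mem (hNU _ (by simpa using hN.conj_mem x hx g⁻¹) u hu)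
  have hU_of_not : ∀ x ∉ N, ∀ v ∈ U₀, π x v ∈ U' := by
    intro x hx v hv
    rw [show x = g * (g⁻¹ * x) by group, ← hcomp]
    exact Submodule.mem_map_of_mem (hNU _ (hmul hginv hx) v hv)
  have hU'_of_not : ∀ x ∉ N, ∀ v ∈ U', π x v ∈ U₀ := by
    intro x hx v hv
    obtain ⟨u, hu, rfl⟩ := Submodule.mem_map.mp hv
    rw [hcomp]
    exact hNU _ (hmul hx hg) u hu
  refine ⟨fun v hv => ?_, fun v hv => ?_⟩
  · obtain ⟨a, ha, b, hb, rfl⟩ := Submodule.mem_sup.mp hv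
    rw [map_add]
    by_cases hx : x ∈ N
    · exact Submodule.add_mem _ (Submodule.mem_sup_left (hNU x hx a ha))
        (Submodule.mem_sup_right (hNU' x hx b hb))
    · exact Submodule.add_mem _ (Submodule.mem_sup_right (hU_of_not x hx a ha))
        (Submodule.mem_sup_left (hU'_of_not x hx b hb))
  · obtain ⟨hvU, hvU'⟩ := Submodule.mem_inf.mp hv
    by_cases hx : x ∈ N
    · exact Submodule.mem_inf.mpr ⟨hNU x hx v hvU, hNU' x hx v hvU'⟩
    · exact Submodule.mem_inf.mpr ⟨hU'_of_not x hx v hvU', hU_of_not x hx v hvU⟩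

/-- **Clifford, index two.**  Let `π` be an irreducible representation of `G` on `V` over a field,
`φ : H →* G` a homomorphism whose image `N` has index `2`, and suppose `π ∘ φ` is not irreducible.
Then there is a sub-`H`-representation `W` of `π ∘ φ` (a `φ(H)`-stable subspace `U`), neither `0`
nor `V`, such that for EVERY `g ∉ N` one has `U ∩ π(g)U = 0` and `U + π(g)U = V` (so
`V = U ⊕ π(g)U`, i.e. `π ≅ Ind_N^G U`).  Proof: `U + π(g)U` and `U ∩ π(g)U` are `G`-stable
(`stable_sup_inf_of_index_two`), hence `V` and `0`. [cite: Clifford1937, Thm. 1] -/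
theorem exists_isCompl_of_not_isIrreducible_comp {k : Type*} [Field k] {G H : Type*} [Group G]
    [Group H] {V : Type*} [AddCommGroup V] [Module k V] (π : _root_.Representation k G V)
    (hπ : π.IsIrreducible) (φ : H →* G) (hφ : φ.range.index = 2)
    (hred : ¬ _root_.Representation.IsIrreducible (π.comp φ)) :
    ∃ W : Subrepresentation (π.comp φ), W ≠ ⊥ ∧ W ≠ ⊤ ∧
      ∀ g : G, g ∉ φ.range → W.toSubmodule ⊓ W.toSubmodule.map (π g) = ⊥ ∧
        W.toSubmodule ⊔ W.toSubmodule.map (π g) = ⊤ := by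
  classical
  haveI := hπ
  -- `V ≠ 0`
  have hVbt : (⊥ : Submodule k V) ≠ ⊤ := fun h' =>
    (bot_ne_top : (⊥ : Subrepresentation π) ≠ ⊤) (Subrepresentation.toSubmodule_injective h')
  haveI hnt : Nontrivial (Subrepresentation (π.comp φ)) :=
    ⟨⟨⊥, ⊤, fun h => hVbt (congrArg Subrepresentation.toSubmodule h)⟩⟩
  -- a proper non-zero `N`-stable subspace
  obtain ⟨W, hWb, hWt⟩ : ∃ W : Subrepresentation (π.comp φ), W ≠ ⊥ ∧ W ≠ ⊤ := by
    by_contra! hall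
    exact hred ⟨fun W => (em (W = ⊥)).imp_right (hall W)⟩
  set U : Submodule k V := W.toSubmodule with hUdef
  have hUb : U ≠ ⊥ := fun h => hWb (Subrepresentation.toSubmodule_injective h)
  have hUt : U ≠ ⊤ := fun h => hWt (Subrepresentation.toSubmodule_injective h)
  have hHU : ∀ (h : H), ∀ v ∈ U, π (φ h) v ∈ U := fun h v hv => W.apply_mem_toSubmodule h hv
  refine ⟨W, hWb, hWt, fun g hg => ?_⟩
  have hst := stable_sup_inf_of_index_two π φ hφ hHU hg
  let S₁ : Subrepresentation π := ⟨U ⊔ U.map (π g), fun x v hv => (hst x).1 v hv⟩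
  let S₂ : Subrepresentation π := ⟨U ⊓ U.map (π g), fun x v hv => (hst x).2 v hv⟩
  have hS₁ : S₁ = ⊤ := by
    rcases IsSimpleOrder.eq_bot_or_eq_top S₁ with h | h
    · exfalso
      apply hUb
      have h' : U ⊔ U.map (π g) = ⊥ := congrArg Subrepresentation.toSubmodule h
      exact le_bot_iff.mp (le_sup_left.trans h'.le)
    · exact h
  have hS₂ : S₂ = ⊥ := by
    rcases IsSimpleOrder.eq_bot_or_eq_top S₂ with h | h
    · exact h
    · exfalso
      apply hUt
      have h' : U ⊓ U.map (π g) = ⊤ := congrArg Subrepresentation.toSubmodule h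
      exact top_le_iff.mp (h'.ge.trans inf_le_left)
  exact ⟨congrArg Subrepresentation.toSubmodule hS₂, congrArg Subrepresentation.toSubmodule hS₁⟩

/-- In the situation of Clifford's theorem, `dim V = 2 · dim U` (`V = U ⊕ π(g)U` and
`π(g) : U ≅ π(g)U`). [cite: Clifford1937, Thm. 1] -/
theorem finrank_eq_two_mul_of_isCompl_map [FiniteDimensional k V] (π : _root_.Representation k G V)
    {U : Submodule k V} {g : G} (hinf : U ⊓ U.map (π g) = ⊥) (hsup : U ⊔ U.map (π g) = ⊤) :
    Module.finrank k V = 2 * Module.finrank k U := by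
  have h := Submodule.finrank_sup_add_finrank_inf_eq U (U.map (π g))
  rw [hinf, hsup, finrank_bot, add_zero, finrank_top] at h
  rw [h, (Submodule.equivMapOfInjective (π g) (representation_apply_injective π g) U).finrank_eq]
  ring

/-- **The Clifford subspace is an irreducible `H`-representation.**  With `π` irreducible on `G`,
`[G : φ(H)] = 2`, `g ∉ φ(H)` and `W ≠ 0` a sub-`H`-representation with `W ∩ π(g)W = 0`, the
representation of `H` on `W` is irreducible: for a sub-`H`-representation `W₀ ≤ W`, the `G`-stable
`W₀ + π(g)W₀` is `0` (so `W₀ = 0`) or `V` (so `W = W₀ + (W ∩ π(g)W₀) = W₀` by modularity).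
[cite: Clifford1937, Thm. 1] -/
theorem isIrreducible_toRepresentation_of_index_two (π : _root_.Representation k G V)
    (hπ : π.IsIrreducible) (φ : H →* G) (hφ : φ.range.index = 2)
    (W : Subrepresentation (π.comp φ)) (hWb : W ≠ ⊥) {g : G} (hg : g ∉ φ.range)
    (hinf : W.toSubmodule ⊓ W.toSubmodule.map (π g) = ⊥) :
    W.toRepresentation.IsIrreducible := by
  classical
  haveI := hπ
  set U : Submodule k V := W.toSubmodule with hUdef
  have hUb : U ≠ ⊥ := fun h => hWb (Subrepresentation.toSubmodule_injective h)
  -- nontriviality of the lattice of subrepresentations of `W`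
  have hbt : (⊥ : Submodule k U) ≠ ⊤ := by
    intro h
    apply hUb
    rw [eq_bot_iff]
    intro v hv
    have : (⟨v, hv⟩ : U) ∈ (⊥ : Submodule k U) := by rw [h]; exact Submodule.mem_top
    rw [Submodule.mem_bot] at this ⊢
    exact congrArg Subtype.val this
  haveI : Nontrivial (Subrepresentation W.toRepresentation) :=
    ⟨⟨⊥, ⊤, fun h => hbt (congrArg Subrepresentation.toSubmodule h)⟩⟩
  refine ⟨fun W₀ => ?_⟩
  -- push `W₀` into `V`
  set U₀ : Submodule k V := W₀.toSubmodule.map U.subtype with hU₀def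
  have hU₀le : U₀ ≤ U := by
    rintro _ ⟨w, hw, rfl⟩
    exact w.2
  have hHU₀ : ∀ (h : H), ∀ v ∈ U₀, π (φ h) v ∈ U₀ := by
    rintro h _ ⟨w, hw, rfl⟩
    exact ⟨W.toRepresentation h w, W₀.apply_mem_toSubmodule h hw, rfl⟩
  have hst := stable_sup_inf_of_index_two π φ hφ hHU₀ hg
  let S : Subrepresentation π := ⟨U₀ ⊔ U₀.map (π g), fun x v hv => (hst x).1 v hv⟩
  -- `W₀` is determined by `U₀`
  have hback : ∀ w : U, (w : V) ∈ U₀ → w ∈ W₀.toSubmodule := by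
    rintro w ⟨w', hw', hww'⟩
    have : w' = w := Subtype.ext hww'
    exact this ▸ hw'
  rcases IsSimpleOrder.eq_bot_or_eq_top S with h | h
  · left
    have h' : U₀ ⊔ U₀.map (π g) = ⊥ := congrArg Subrepresentation.toSubmodule h
    have hU₀ : U₀ = ⊥ := le_bot_iff.mp (le_sup_left.trans h'.le)
    apply Subrepresentation.toSubmodule_injective
    change W₀.toSubmodule = ⊥
    rw [eq_bot_iff]
    intro w hw
    have : (w : V) ∈ U₀ := ⟨w, hw, rfl⟩
    rw [hU₀, Submodule.mem_bot] at this
    rw [Submodule.mem_bot]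
    exact Subtype.ext this
  · right
    have h' : U₀ ⊔ U₀.map (π g) = ⊤ := congrArg Subrepresentation.toSubmodule h
    -- modular law: `U = U ⊓ (U₀ ⊔ gU₀) = U₀ ⊔ (U ⊓ gU₀)` and `U ⊓ gU₀ ≤ U ⊓ gU = ⊥`
    have hUeq : U ≤ U₀ := by
      have h1 : U ≤ (U₀ ⊔ U₀.map (π g)) ⊓ U := le_inf (h'.symm ▸ le_top) le_rfl
      rw [sup_inf_assoc_of_le _ hU₀le] at h1
      have h2 : U₀.map (π g) ⊓ U ≤ ⊥ := by
        rw [← hinf, inf_comm]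
        exact inf_le_inf_left _ (Submodule.map_mono hU₀le)
      exact h1.trans (sup_le le_rfl (h2.trans bot_le))
    apply Subrepresentation.toSubmodule_injective
    change W₀.toSubmodule = ⊤
    rw [eq_top_iff]
    intro w _
    exact hback w (hUeq w.2)

end Abstract

end Summit.Langlands.Langlands.Cruxes.QuadraticImprimitiveSurfaces.Clifford
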